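import Literature.MathematicalPhysics.QuantumFieldTheory.BalabanImbrieJaffe1984to88.BIJ88NeumannPropagator227Torus

/-!
# `BalabanImbrieJaffe1984to88.BIJ88DeltaLoc234Torus` — T. Bałaban, J. Imbrie, A. Jaffe, *Effective action and cluster properties of the
abelian Higgs model*, Commun. Math. Phys. **114** (1988) 257–315 [BalabanImbrieJaffe1988], Sect. 2 p. 263 [PDF 7] and Sect. 4 p. 275
[PDF 19]: **(2.27) `G̃_k(u)`, (2.28) `G_{k,loc}(u)`, (2.34) `Δ_{k,loc}(u)` (with the region form `Δ_k(Ω,u)` of (2.35)) and (4.12) `φ_k`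
WITH BODIES ON THE TORUS OF RECORD**, over the constructed Neumann propagators `G_k(□_α,u)` of the companion
`BIJ88NeumannPropagator227Torus`, together with **THE GAUGE COVARIANCE OF ALL OF THEM** — `G_k(Ω,u^h) = M_hG_k(Ω,u)M_hᴴ`,
`Δ_{k,loc}(u^h) = M^{(k)}_hΔ_{k,loc}(u)M^{(k)}_hᴴ`, hence the invariance of the scalar quadratic form of (4.1) under the simultaneous
transformation of background and field (the scalar rotation of (5.4.5) p. 282, [I] (6.3.2)) — and the combinatorial core of the support
statement (2.37); and (5.6.12) WITH `w₆` for the torus `G_{k,loc}`, the per-cube (5.6.11) hypotheses of my gen-11 chain discharged.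

statement-level skeleton of published theorems with citation tags; proofs where landed; nothing here is a claim about the Yang–Mills mass gap

PDF held: `paper:balaban1988-cmp114-bij-abelian-higgs-effective-action` (journal page = PDF page + 256); p. 262–263 [PDF 6–7] and p. 282
[PDF 26] read as images this session (renders `HOME/lit-balaban-p31/renders/original-p006/p007-x2.png`,
`HOME/lit-balaban-r16/renders/cmp114/original-p026-x2.png`); p. 275 [PDF 19] (4.12) as quoted in r18's `BIJ88Sect4Statements`; [I] =
[BalabanImbrieJaffe1985] (CMP **97**) p. 303 (2.7)–(2.8), p. 320 (6.3.2) as quoted in p11's `BIJ85BlockAveragesTorus`/`BIJ85ScalarPropagatorTorusK`.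

CITATION HEADER (lean-in-tree rule).  Part of the lit-balaban TYPED SKELETON (HOME `run/shared/lean/pub/lit-balaban/`), PHASE-2 proof
seat p31 gen 15 (unit `lit-balaban-p31-g15`; TAKING line HOME/STATUS.md 2026-08-22T10:49:49Z; free-target protocol G.5-34(d), owner's
successor item 2 (i) of `HOME/lit-balaban-r18/C2S14-CLOSURE.md` §5).  WHAT IS REPRODUCED: rows **C2.Eq2.27**, **C2.Eq2.28**, **C2.Eq2.34**
(+ the support shape **C2.Eq2.37**), **C2.Eq4.12** of `HOME/lit-balaban-r18/ROWS-C2.md` (owner r18) as TORUS OBJECTS WITH BODIES over typed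
weight/cut-off data, with their gauge covariance (kind «model instance / definitions with bodies + theorems»; no `Prop`-valued fact
introduced); the decls of record for the printed displays remain r18's ring/kernel-level shapes `BIJ88Sect2Statements.convexComb`/`loc`/
`deltaLoc`/`Zeta229`/`IsConvexWeights` and `BIJ88Sect4Statements.phiK` — here INSTANTIATED BY NAME where they are ring-level
(`deltaLoc_blocks_eq_deltaLocT`, `phiKT_eq_phiK`; (2.27)–(2.28) through my gen-11 `BIJ88Eq5612W6.gLoc` = `loc ζ″ (convexComb λ ·)`).

THE PRINTED TEXT (verbatim).  p. 263 [PDF 7]: *"Define G̃_k(u; x₁,x₂) = Σ_α λ_αG_k(□_α, u; x₁,x₂) (2.27) as a convex combination of Neumann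
propagators. The convex combination varies smoothly with (x₁+x₂)/2; it involves at most 2^d terms and is concentrated on □_α when (x₁+x₂)/2
is near the center of □_α. We then put G_{k,loc}(u; x₁,x₂) = ζ″_k(x₁,x₂)G̃_k(u; x₁,x₂), (2.28) where ζ″_k(x₁,x₂) is a smooth function of
x₁ − x₂, ζ″_k(x₁,x₂) = 0, if |x₁ − x₂| ≧ (1/4L) r(e_{k−1}), 1, if |x₁ − x₂| ≦ (1/8L) r(e_{k−1}). (2.29) … We use G_{k,loc} to define a
localized quadratic form for scalar fields, Δ_{k,loc}(u) = a_kI − a_k²Q_k(u)G_{k,loc}(u)Q_k*(u). (2.34) Here we have simply replaced G_k(Ω,u)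
with G_{k,loc} in the definition of Δ_k(Ω,u); see (I.4.6.4). … Δ_{k,loc}(u; x₁,x₂) = 0 for |x₁ − x₂| ≧ (1/2L) r(e_{k−1}). (2.37)"*  p. 275
[PDF 19]: *"The fields u, φ appear in the diagrams through the η-lattice minimizers u_k and φ_k = a_kG_{k,loc}(u_k)Q_k^*(u_k)φ, (4.12)"*.
p. 282 [PDF 26]: *"The background gauge transformation u_{k,b} → u′_{k,b} = u_{k,b} exp(−ie_kη(∂Λ̄₃^{(k)}C_k□A′)(b)), φ(x) → φ(x)exp(ie_k(Λ̄₃^{(k)}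
C_k□A′)(x)), ψ(y) → ψ(y)exp(ie_k(Λ̄₃^{(k)}C_k□A′)(y)), (5.4.5) is now performed on the term localized in □₀."*  [I] p. 320: *"Our procedure
for constructing S_k has the general invariance S_k(u_ke^{−iη∂λ}, e^{iλ}φ) = S_k(u_k, φ) (6.3.2) for a gauge transformation λ. While we do not
prove this invariance here, it is clear in the case of the quadratic forms for which we write explicit formulas."*

THE MECHANISM.  (§1) GAUGE COVARIANCE OF THE REGION PROPAGATOR.  Under `u ↦ u^h` (`u^h_b = h(b₋)u_bh(b₊)^{−1}`, [I] (2.7)) the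
Neumann-cut covariant derivative and the restricted `k`-level average transform ENTRYWISE by phases — `(χ_ΩD_{u^h})(b,x) =
h(b₋)(χ_ΩD_u)(b,x)conj h(x)` (`dN_gaugeAct_apply`), `Q_k(u^h)|_Ω(y,x) = h(y_corner)Q_k(u)|_Ω(y,x)conj h(x)` (`qMatK_gaugeAct_apply`, from
`u^h(Γ^{(k)}_{x_k,x}) = h(x_k)u(Γ^{(k)})h(x)^{−1}`, `holCK_gaugeAct` = p11's (2.8)_k at kernel level) — so both Gram matrices are conjugated by the
diagonal unitary `M_h = diag(h(x))` (`gram_conj_of_entry`: the bond/corner phases have modulus one and cancel), hence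
`H_Ω(u^h) = M_hH_Ω(u)M_hᴴ` (`nOp_gaugeAct`), the padded operator likewise, and BY THE UNIQUENESS of the inverse on `ℓ²(Ω)`
(companion's `eq_gBox_of_left_inverse`) **`G_k(Ω,u^h) = M_hG_k(Ω,u)M_hᴴ`** (`gBox_gaugeAct`; kernel form `gBox_gaugeAct_apply`).  (§2) THE
OBJECTS: `gTilde` (2.27) over a finite cube family `cube : ι → Finset` (each a union of `k`-blocks) and real weights `lam α x₁ x₂`;
`gLocT` (2.28) := `BIJ88Eq5612W6.gLoc ζ″ λ (G_k(□_α,u))_α` BY NAME (`gLocT_apply`: `= ζ″·G̃`); `qMatT` = the full `Q_k(u)` (acts as p11's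
`qCovK`, `qMatT_mulVec`); **`deltaLocT` (2.34) := `a·1 − a²·Q_k(u)G_{k,loc}(u)Q_k(u)ᴴ`** on `ℓ²(T^{(j+k)})` and `deltaRegion` := the same with
`G_k(Ω,u)` (*"Δ_k(Ω,u); see (I.4.6.4)"*); `phiKT` (4.12) := `a·G_{k,loc}(u)Q_k(u)ᴴφ`; dictionaries `phiKT_eq_phiK` (r18's (4.12) shape over
real-linear maps) and `deltaLoc_blocks_eq_deltaLocT` (r18's ring-level (2.34) `deltaLoc` in the `ℝ`-algebra of complex matrices on
`T^{(j+k)} ⊕ T^{(j)}`, rectangular factors embedded as blocks — the complex twin of p02's `deltaLoc_fromBlocks_toBlocks₁₁`).  (§3) COVARIANCE: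
`G̃_k(u^h) = M_hG̃_k(u)M_hᴴ`, `G_{k,loc}(u^h) = M_hG_{k,loc}(u)M_hᴴ` (real weights/cut-off commute with the phases), `Q_k(u^h) = M^{(k)}_hQ_k(u)M_hᴴ`
with `M^{(k)}_h = diag(h(y_corner))` (`qMatT_gaugeAct` — (2.8)_k as a matrix identity), whence **`Δ_{k,loc}(u^h) = M^{(k)}_hΔ_{k,loc}(u)M^{(k)}_hᴴ`**
(`deltaLocT_gaugeAct`; `Δ_k(Ω,·)` likewise), the kernel form `Δ_{k,loc}(u^h;y₁,y₂) = h(y₁,c)Δ_{k,loc}(u;y₁,y₂)conj h(y₂,c)`, and the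
INVARIANCE OF THE SCALAR QUADRATIC FORM OF (4.1) under `(u, ψ) ↦ (u^h, hψ)`: as a sesquilinear pairing (`form_deltaLocT_gaugeAct`) and
TERMWISE (`scalarForm_term_gaugeAct`), so for every restricted double sum `Σ_{y₁,y₂∈Λ₈}` = r18's `Term41.scalarForm` shape
(`scalarForm_sum_gaugeAct`) — the scalar-rotation step of (5.4.5) for the CONCRETE `Δ_{k,loc}`; `φ_k[u^h](hψ) = hφ_k[u](ψ)`
(`phiKT_gaugeAct`).  (§4) (2.37), THE CORE: an off-diagonal entry `Δ_{k,loc}(u;y₁,y₂)` vanishes as soon as `ζ″` vanishes on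
`B^k(y₁) × B^k(y₂)` (`deltaLocT_apply_eq_zero`); `Δ_{k,loc}(u)` is Hermitian for symmetric weight/cut-off data (`deltaLocT_conjTranspose`).

WHAT IS PROVED (0 `sorry`, standard axioms; definitions with bodies `mulOp`, `mulOpK`, `gTilde`, `gLocT`, `qMatT`, `deltaLocT`,
`deltaRegion`, `phiKT` + theorems; no `Prop`-valued fact).
* §1 `mulOp_mul_conjTranspose`, `conjTranspose_mul_mulOp`, `mulOpK_mul_conjTranspose`, `conjTranspose_mul_mulOpK`, `mulOp_sandwich_apply`,
  **`dN_gaugeAct_apply`**, **`holCK_gaugeAct`**, **`qMatK_gaugeAct_apply`**, `gram_dN_gaugeAct`, `gram_qMatK_gaugeAct`, **`nOp_gaugeAct`**,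
  `mulOp_cproj_conjTranspose`, `mulOp_proj_conjTranspose`, `nPad_gaugeAct`, **`gBox_gaugeAct`**, **`gBox_gaugeAct_apply`**.
* §2 `gTilde_apply`, **`gLocT_apply`**, `qMatT_mulVec`, `qMatT_apply`, **`phiKT_eq_phiK`**, **`deltaLoc_blocks_eq_deltaLocT`**.
* §3 **`gTilde_gaugeAct`**, **`gLocT_gaugeAct`**, **`qMatT_gaugeAct`**, `qMatT_conjTranspose_gaugeAct`, **`deltaLocT_gaugeAct`**,
  **`deltaRegion_gaugeAct`**, **`form_deltaLocT_gaugeAct`**, `deltaLocT_gaugeAct_apply`, **`scalarForm_term_gaugeAct`**,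
  **`scalarForm_sum_gaugeAct`**, `mulOpK_mulVec`, `form_deltaRegion_gaugeAct`, **`phiKT_gaugeAct`**.
* §4 `qGq_apply_eq_zero`, **`deltaLocT_apply_eq_zero`**, **`deltaLocT_conjTranspose`**.
* §5 **`oneStep_gLocT`** (the two p. 287 displays for the torus `G_{k,loc}`, exact, `w′₆` = gen 11's defect `w6prime`), **`eq5612_gLocT`**
  ((5.6.12) with `w₆` for the torus `G_{k,loc}`, every `n̄`, by name from gen 11's `eq5612_gLoc` — whose per-cube whole-lattice inverse
  hypotheses `G_α·H_α = 1` of `eq5612_neumann` are here REPLACED by the companion's honest `eq5611_gBox` on `ℓ²(□_α)`).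
HONEST SCOPE.  Definitions, algebra and gauge covariance only.  NOT here: the decay/closeness (2.30)/(2.31)/(2.35)/(2.36) (B4's random-walk
theorem — owner item 2 (ii), the B4-box ↔ torus-cube carrier bridge; p02's hence-steps `BIJ88OpDecay230Proof`/`BIJ88Close235Proof` are the
real-kernel currency), the torus instance of the weights `λ_α` (p13's `ℤ^d` `cwt`) and of the profile `ζ″` (p13's `BIJ88Cutoffs21`) — both
DATA here —, the metric bookkeeping turning `deltaLocT_apply_eq_zero` into the printed radius `(1/2L)r(e_{k−1})`, the identification of
the `j = 0` instance with the `Δloc` slot of r18's `Term41` (a ℂ-valued bond-field argument there; the objects here take the `U(1)` field),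
Hölder members, (5.4.6).  Uniform lattice weights absorbed into `a`, `c`, `L^{−kd}` as in gen 10; standing range `j + k ≤ m + K`.
Imports: the companion `BIJ88NeumannPropagator227Torus` (this seat, same gen).  Unit `lit-balaban-p31` (literature-prover-lit-balaban-p31-
g15-0), 2026-08-22.  NOT summit progress.
-/

open scoped BigOperators Matrix ComplexConjugate
open Finset Matrix

namespace Literature.MathematicalPhysics.QuantumFieldTheory.BalabanImbrieJaffe1984to88.BIJ88DeltaLoc234Torus

open Literature.MathematicalPhysics.QuantumFieldTheory.Balaban1983to89
open BIJ88Sect3Statements (U1 toC cfg covD starB mem_starB toC_mul toC_one toC_inv norm_toC)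
open BIJ85Sect1Model (HiggsField)
open BIJ85BlockAveragesTorus BIJ85BlockAveragesTorusK
open BIJ88Vj5610Operator (dMat qMat chiN hMat dMat_mulVec qMat_mulVec)
open BIJ88NeumannNoZeroModesTorus BIJ88NeumannPropagator227Torus
open BIJ88Eq5612W6 (gLoc gLoc_apply w6 w6prime eq5612_gLoc oneStep_w6prime)
open GaugeField (gaugeAct)

noncomputable section

variable {P : Params} {j : ℕ}

/-! ## §1 Gauge covariance of `χ_ΩD_u`, `Q_k(u)|_Ω`, the Neumann operator and `G_k(Ω,u)` -/

/-- The gauge transformation `h : T^{(j)} → U(1)` as the diagonal unitary `M_h = diag(h(x))` on `ℓ²(T^{(j)})` ((2.7): `φ ↦ hφ`).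
[cite: BalabanImbrieJaffe1985, (2.7) p.303] -/
def mulOp (h : GaugeTransf P j U1) : Matrix (Balaban1983to89.Site P j) (Balaban1983to89.Site P j) ℂ := diagonal fun x => toC (h x)

/-- The same transformation read on the unit lattice `T^{(j+k)}` at the corner points ((2.8)_k: `(Q_k(u)φ)^h = h(y_corner)·Q_k(u)φ`, p11's
`qCovK_gaugeAct`): `diag(h(cornerIter k y))`. [cite: BalabanImbrieJaffe1985, (2.8) p.303] -/
def mulOpK (h : GaugeTransf P j U1) (k : ℕ) : Matrix (Balaban1983to89.Site P (j+k)) (Balaban1983to89.Site P (j+k)) ℂ :=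
  diagonal fun y => toC (h (cornerIter k y))

section Sandwich

variable {n : Type*} [Fintype n] [DecidableEq n]

/-- kernel: the entries of a diagonal sandwich `diag(d)·B·diag(d)ᴴ`. [cite: BalabanImbrieJaffe1985, (2.7) p.303] -/
private theorem sandwich_apply {m : Type*} [Fintype m] [DecidableEq m] (d : n → ℂ) (e : m → ℂ) (B : Matrix n m ℂ) (i : n) (l : m) :
    (diagonal d * B * (diagonal e)ᴴ) i l = d i * B i l * (starRingEnd ℂ) (e l) := by
  rw [diagonal_conjTranspose, mul_diagonal, diagonal_mul, Pi.star_apply, Complex.star_def]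

/-- kernel: a diagonal of `U(1)` phases is unitary: `diag(d)·diag(d)ᴴ = 1`. [cite: BalabanImbrieJaffe1985, (2.7) p.303] -/
private theorem diagonal_mul_conjTranspose_of_unit {d : n → ℂ} (hd : ∀ i, d i * (starRingEnd ℂ) (d i) = 1) :
    diagonal d * (diagonal d)ᴴ = 1 := by
  rw [diagonal_conjTranspose, diagonal_mul_diagonal, ← diagonal_one]
  congr 1; funext i; rw [Pi.star_apply, Complex.star_def, hd]

/-- kernel: `diag(d)ᴴ·diag(d) = 1` for `U(1)` phases. [cite: BalabanImbrieJaffe1985, (2.7) p.303] -/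
private theorem conjTranspose_mul_diagonal_of_unit {d : n → ℂ} (hd : ∀ i, d i * (starRingEnd ℂ) (d i) = 1) :
    (diagonal d)ᴴ * diagonal d = 1 := by
  rw [diagonal_conjTranspose, diagonal_mul_diagonal, ← diagonal_one]
  congr 1; funext i; rw [Pi.star_apply, Complex.star_def, mul_comm, hd]

end Sandwich

/-- kernel: `M_hM_hᴴ = 1`. [cite: BalabanImbrieJaffe1985, (2.7) p.303] -/
theorem mulOp_mul_conjTranspose (h : GaugeTransf P j U1) : mulOp h * (mulOp h)ᴴ = 1 :=
  diagonal_mul_conjTranspose_of_unit fun x => toC_mul_conj (h x)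

/-- kernel: `M_hᴴM_h = 1`. [cite: BalabanImbrieJaffe1985, (2.7) p.303] -/
theorem conjTranspose_mul_mulOp (h : GaugeTransf P j U1) : (mulOp h)ᴴ * mulOp h = 1 :=
  conjTranspose_mul_diagonal_of_unit fun x => toC_mul_conj (h x)

/-- kernel: `M^{(k)}_hM^{(k)}_hᴴ = 1` on the unit lattice. [cite: BalabanImbrieJaffe1985, (2.8) p.303] -/
theorem mulOpK_mul_conjTranspose (h : GaugeTransf P j U1) (k : ℕ) : mulOpK h k * (mulOpK h k)ᴴ = 1 :=
  diagonal_mul_conjTranspose_of_unit fun y => toC_mul_conj (h (cornerIter k y))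

/-- kernel: `M^{(k)}_hᴴM^{(k)}_h = 1`. [cite: BalabanImbrieJaffe1985, (2.8) p.303] -/
theorem conjTranspose_mul_mulOpK (h : GaugeTransf P j U1) (k : ℕ) : (mulOpK h k)ᴴ * mulOpK h k = 1 :=
  conjTranspose_mul_diagonal_of_unit fun y => toC_mul_conj (h (cornerIter k y))

/-- kernel: the entries of a conjugation by `M_h`: `(M_hBM_hᴴ)(x,y) = h(x)B(x,y)conj h(y)`. [cite: BalabanImbrieJaffe1985, (2.7) p.303] -/
theorem mulOp_sandwich_apply (h : GaugeTransf P j U1) (B : Matrix (Balaban1983to89.Site P j) (Balaban1983to89.Site P j) ℂ)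
    (x y : Balaban1983to89.Site P j) : (mulOp h * B * (mulOp h)ᴴ) x y = toC (h x) * B x y * (starRingEnd ℂ) (toC (h y)) :=
  sandwich_apply _ _ _ _ _

/-- **(2.7) for the Neumann-cut covariant derivative**: `χ_ΩD_{u^h} = M^{bond}_h·χ_ΩD_u·M_hᴴ` entrywise —
`(χ_ΩD_{u^h})(b,x) = h(b₋)·(χ_ΩD_u)(b,x)·conj h(x)` (`u^h_b = h(b₋)u_bh(b₊)^{−1}`). [cite: BalabanImbrieJaffe1985, (2.7) p.303] -/
theorem dN_gaugeAct_apply (c : ℝ) (h : GaugeTransf P j U1) (U : GaugeField P j U1) (Ω : Finset (Balaban1983to89.Site P j))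
    (b : PBond P j) (x : Balaban1983to89.Site P j) :
    dN c (gaugeAct h U) Ω b x = toC (h b.src) * dN c U Ω b x * (starRingEnd ℂ) (toC (h x)) := by
  rw [dN_apply, dN_apply]
  split_ifs with hb
  · simp only [dMat, Matrix.of_apply, cfg, toC_gaugeAct, conj_toC]
    have k1 : (if x = b.tgt then toC (h b.src) * toC (U b) * (toC (h b.tgt))⁻¹ else 0)
        = toC (h b.src) * (if x = b.tgt then toC (U b) else 0) * (toC (h x))⁻¹ := by
      split_ifs with e
      · rw [e]
      · ring
    have k2 : (if x = b.src then (1 : ℂ) else 0) = toC (h b.src) * (if x = b.src then (1 : ℂ) else 0) * (toC (h x))⁻¹ := by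
      split_ifs with e
      · rw [e, mul_one, mul_inv_cancel₀ (toC_ne_zero _)]
      · ring
    conv_lhs => rw [k1, k2]
    ring
  · ring

/-- **(2.7)/(2.8) along the composite contour**: `u^h(Γ^{(k)}_{x_k,x}) = h(x_k)·u(Γ^{(k)}_{x_k,x})·h(x)^{−1}` (p11's one-level `holC_gaugeAct`
iterated with `lineIter_gaugeAct`; standing range). [cite: BalabanImbrieJaffe1985, (2.8) p.303] -/
theorem holCK_gaugeAct (h : GaugeTransf P j U1) (U : GaugeField P j U1) :
    ∀ (k : ℕ), j + k ≤ P.m + P.K → ∀ x : Balaban1983to89.Site P j,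
      holCK (gaugeAct h U) k x = toC (h (cornerIter k (blkIter k x))) * holCK U k x * (toC (h x))⁻¹
  | 0, _, x => by rw [holCK_zero, holCK_zero, mul_one, cornerIter_zero, blkIter_zero, mul_inv_cancel₀ (toC_ne_zero (h x))]
  | k + 1, hk, x => by
    have hk' : j + k + 1 ≤ P.m + P.K := by omega
    rw [holCK_succ, holCK_succ, holCK_gaugeAct h U k (by omega) x, lineIter_gaugeAct h U k (by omega), holC_gaugeAct hk',
      cornerIter_succ, blkIter_succ]
    have h1 := toC_ne_zero (h (cornerIter k (blkIter k x)))
    field_simp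

/-- **(2.8)_k for the restricted average as a matrix**: `Q_k(u^h)|_Ω(y,x) = h(y_corner)·Q_k(u)|_Ω(y,x)·conj h(x)`.
[cite: BalabanImbrieJaffe1985, (2.8) p.303] -/
theorem qMatK_gaugeAct_apply {k : ℕ} (hk : j + k ≤ P.m + P.K) (h : GaugeTransf P j U1) (U : GaugeField P j U1)
    (Ω : Finset (Balaban1983to89.Site P j)) (y : Balaban1983to89.Site P (j+k)) (x : Balaban1983to89.Site P j) :
    qMatK (gaugeAct h U) k Ω y x = toC (h (cornerIter k y)) * qMatK U k Ω y x * (starRingEnd ℂ) (toC (h x)) := by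
  rw [qMatK_apply, qMatK_apply]
  split_ifs with hyx
  · rw [holCK_gaugeAct h U k hk x, mem_blockK.1 hyx.2, conj_toC]; ring
  · ring

section GramCovariance

variable {m n : Type*} [Fintype m] [Fintype n] [DecidableEq n]

/-- kernel: if `A′(b,x) = e(b)A(b,x)conj d(x)` with `|e(b)| = 1`, then `A′ᴴA′ = diag(d)·AᴴA·diag(d)ᴴ`. [cite: BalabanImbrieJaffe1985, (2.7) p.303] -/
private theorem gram_conj_of_entry {A A' : Matrix m n ℂ} {e : m → ℂ} {d : n → ℂ} (he : ∀ b, (starRingEnd ℂ) (e b) * e b = 1)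
    (hA : ∀ b x, A' b x = e b * A b x * (starRingEnd ℂ) (d x)) : A'ᴴ * A' = diagonal d * (Aᴴ * A) * (diagonal d)ᴴ := by
  ext x x'
  rw [sandwich_apply, Matrix.mul_apply, Matrix.mul_apply, Finset.mul_sum, Finset.sum_mul]
  refine Finset.sum_congr rfl fun b _ => ?_
  simp only [conjTranspose_apply, hA, Complex.star_def, map_mul, Complex.conj_conj]
  linear_combination ((starRingEnd ℂ) (A b x) * A b x' * d x * (starRingEnd ℂ) (d x')) * he b

end GramCovariance

/-- **`−Δ^N_{u^h,Ω} = M_h(−Δ^N_{u,Ω})M_hᴴ`** (the Neumann form is gauge covariant). [cite: BalabanImbrieJaffe1985, (2.7) p.303] -/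
theorem gram_dN_gaugeAct (c : ℝ) (h : GaugeTransf P j U1) (U : GaugeField P j U1) (Ω : Finset (Balaban1983to89.Site P j)) :
    (dN c (gaugeAct h U) Ω)ᴴ * dN c (gaugeAct h U) Ω = mulOp h * ((dN c U Ω)ᴴ * dN c U Ω) * (mulOp h)ᴴ :=
  gram_conj_of_entry (fun b => conj_mul_toC (h b.src)) (dN_gaugeAct_apply c h U Ω)

/-- **`Q_k(u^h)|_Ωᴴ Q_k(u^h)|_Ω = M_h(Q_k(u)|_Ωᴴ Q_k(u)|_Ω)M_hᴴ`** (standing range). [cite: BalabanImbrieJaffe1985, (2.8) p.303] -/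
theorem gram_qMatK_gaugeAct {k : ℕ} (hk : j + k ≤ P.m + P.K) (h : GaugeTransf P j U1) (U : GaugeField P j U1)
    (Ω : Finset (Balaban1983to89.Site P j)) :
    (qMatK (gaugeAct h U) k Ω)ᴴ * qMatK (gaugeAct h U) k Ω = mulOp h * ((qMatK U k Ω)ᴴ * qMatK U k Ω) * (mulOp h)ᴴ :=
  gram_conj_of_entry (fun y => conj_mul_toC (h (cornerIter k y))) (qMatK_gaugeAct_apply hk h U Ω)

/-- **THE NEUMANN OPERATOR IS GAUGE COVARIANT**: `−Δ^N_{u^h,Ω} + a_kQ_k^*(u^h)Q_k(u^h) = M_h[−Δ^N_{u,Ω} + a_kQ_k^*(u)Q_k(u)]M_hᴴ` (standing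
range). [cite: BalabanImbrieJaffe1985, (6.3.2) p.320] -/
theorem nOp_gaugeAct {k : ℕ} (hk : j + k ≤ P.m + P.K) (a c : ℝ) (h : GaugeTransf P j U1) (U : GaugeField P j U1)
    (Ω : Finset (Balaban1983to89.Site P j)) :
    nOp a c (gaugeAct h U) k Ω = mulOp h * nOp a c U k Ω * (mulOp h)ᴴ := by
  rw [nOp_eq, nOp_eq, gram_dN_gaugeAct, gram_qMatK_gaugeAct hk, Matrix.mul_add, Matrix.add_mul, Matrix.mul_smul, Matrix.smul_mul]

/-- kernel: `M_h·1_{Ωᶜ}·M_hᴴ = 1_{Ωᶜ}` (diagonals commute, `|h| = 1`). [cite: BalabanImbrieJaffe1985, (2.7) p.303] -/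
theorem mulOp_cproj_conjTranspose (h : GaugeTransf P j U1) (Ω : Finset (Balaban1983to89.Site P j)) :
    mulOp h * cproj Ω * (mulOp h)ᴴ = cproj Ω := by
  unfold mulOp cproj
  rw [diagonal_conjTranspose, diagonal_mul_diagonal, diagonal_mul_diagonal]
  congr 1; funext x
  rw [Pi.star_apply, Complex.star_def]
  split_ifs
  · rw [mul_zero, zero_mul]
  · rw [mul_one, toC_mul_conj]

/-- kernel: `M_h·1_Ω·M_hᴴ = 1_Ω`. [cite: BalabanImbrieJaffe1985, (2.7) p.303] -/
theorem mulOp_proj_conjTranspose (h : GaugeTransf P j U1) (Ω : Finset (Balaban1983to89.Site P j)) :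
    mulOp h * proj Ω * (mulOp h)ᴴ = proj Ω := by
  unfold mulOp proj
  rw [diagonal_conjTranspose, diagonal_mul_diagonal, diagonal_mul_diagonal]
  congr 1; funext x
  rw [Pi.star_apply, Complex.star_def]
  split_ifs
  · rw [mul_one, toC_mul_conj]
  · rw [mul_zero, zero_mul]

/-- kernel: the padded operator is gauge covariant too. [cite: BalabanImbrieJaffe1985, (6.3.2) p.320] -/
theorem nPad_gaugeAct {k : ℕ} (hk : j + k ≤ P.m + P.K) (a c : ℝ) (h : GaugeTransf P j U1) (U : GaugeField P j U1)
    (Ω : Finset (Balaban1983to89.Site P j)) :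
    nPad a c (gaugeAct h U) k Ω = mulOp h * nPad a c U k Ω * (mulOp h)ᴴ := by
  rw [nPad, nPad, nOp_gaugeAct hk, Matrix.mul_add, Matrix.add_mul, mulOp_cproj_conjTranspose]

/-- **`G_k(Ω,u)` IS GAUGE COVARIANT**: `G_k(Ω,u^h) = M_hG_k(Ω,u)M_hᴴ` — for every `U(1)` field `u`, every gauge transformation `h`, every
union `Ω` of `k`-blocks, `a_k > 0`, `c ≠ 0` (by the uniqueness of the inverse on `ℓ²(Ω)`, `eq_gBox_of_left_inverse`).  This is the
covariance *"𝒟_k, G_{k,Ax}, and G_k are related by change of gauge formulas"* ([I] p. 312) / (6.3.2) for the CONCRETE region propagators.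
[cite: BalabanImbrieJaffe1985, (6.3.2) p.320] -/
theorem gBox_gaugeAct {k : ℕ} (hk : j + k ≤ P.m + P.K) {a c : ℝ} (hc : c ≠ 0) (ha : 0 < a) (h : GaugeTransf P j U1) (U : GaugeField P j U1)
    {Ω : Finset (Balaban1983to89.Site P j)} (hΩ : IsBlockUnion k Ω) :
    gBox a c (gaugeAct h U) k Ω = mulOp h * gBox a c U k Ω * (mulOp h)ᴴ := by
  have hN := isUnit_nPad hk hc ha U hΩ
  have hN' := isUnit_nPad hk hc ha (gaugeAct h U) hΩ
  symm
  refine eq_gBox_of_left_inverse hN' ?_ ?_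
  · rw [nOp_gaugeAct hk, Matrix.mul_assoc (mulOp h * gBox a c U k Ω), ← Matrix.mul_assoc ((mulOp h)ᴴ), ← Matrix.mul_assoc ((mulOp h)ᴴ),
      conjTranspose_mul_mulOp, Matrix.one_mul, Matrix.mul_assoc (mulOp h), ← Matrix.mul_assoc (gBox a c U k Ω), gBox_mul_nOp hN,
      ← Matrix.mul_assoc, mulOp_proj_conjTranspose]
  · rw [← mulOp_proj_conjTranspose h Ω, Matrix.mul_assoc (mulOp h * gBox a c U k Ω), ← Matrix.mul_assoc ((mulOp h)ᴴ),
      ← Matrix.mul_assoc ((mulOp h)ᴴ), conjTranspose_mul_mulOp, Matrix.one_mul, Matrix.mul_assoc (mulOp h),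
      ← Matrix.mul_assoc (gBox a c U k Ω), gBox_mul_proj, Matrix.mul_assoc]

/-- **`G_k(Ω,u^h; x,y) = h(x)·G_k(Ω,u; x,y)·conj h(y)`** — the kernel form of the gauge covariance. [cite: BalabanImbrieJaffe1985, (6.3.2) p.320] -/
theorem gBox_gaugeAct_apply {k : ℕ} (hk : j + k ≤ P.m + P.K) {a c : ℝ} (hc : c ≠ 0) (ha : 0 < a) (h : GaugeTransf P j U1)
    (U : GaugeField P j U1) {Ω : Finset (Balaban1983to89.Site P j)} (hΩ : IsBlockUnion k Ω) (x y : Balaban1983to89.Site P j) :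
    gBox a c (gaugeAct h U) k Ω x y = toC (h x) * gBox a c U k Ω x y * (starRingEnd ℂ) (toC (h y)) := by
  rw [gBox_gaugeAct hk hc ha h U hΩ]
  exact sandwich_apply _ _ _ _ _

/-! ## §2 (2.27) `G̃_k(u)`, (2.28) `G_{k,loc}(u)`, (2.34) `Δ_{k,loc}(u)`, `Δ_k(Ω,u)`, (4.12) `φ_k` — with bodies on the torus -/

section Objects

variable {ι : Type*} [Fintype ι]

/-- **(2.27)** p. 263 [PDF 7], verbatim: *"Define G̃_k(u; x₁,x₂) = Σ_α λ_αG_k(□_α, u; x₁,x₂) (2.27) as a convex combination of Neumann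
propagators. The convex combination varies smoothly with (x₁+x₂)/2; it involves at most 2^d terms and is concentrated on □_α when (x₁+x₂)/2
is near the center of □_α."* — ON THE TORUS, with the CONSTRUCTED Neumann propagators `G_k(□_α,u)` (`gBox`) of the cubes `□_α`
(`cube α`, unions of `k`-blocks) and the weights `λ_α = lam α x₁ x₂` as data (their shape is r18's `IsConvexWeights`; the `ℤ^d`
construction *"as in [6]"* is p13's `BIJ88ConvexWeights227.cwt`). [cite: BalabanImbrieJaffe1988, (2.27) p.263] -/
def gTilde (a c : ℝ) (U : GaugeField P j U1) (k : ℕ) (cube : ι → Finset (Balaban1983to89.Site P j))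
    (lam : ι → Balaban1983to89.Site P j → Balaban1983to89.Site P j → ℝ) :
    Matrix (Balaban1983to89.Site P j) (Balaban1983to89.Site P j) ℂ :=
  Matrix.of fun x₁ x₂ => ∑ α, (lam α x₁ x₂ : ℂ) * gBox a c U k (cube α) x₁ x₂

/-- **(2.28)** p. 263 [PDF 7], verbatim: *"We then put G_{k,loc}(u; x₁,x₂) = ζ″_k(x₁,x₂)G̃_k(u; x₁,x₂), (2.28) where ζ″_k(x₁,x₂) is a smooth
function of x₁ − x₂"* with the thresholds (2.29) — ON THE TORUS, BY NAME my gen-11 `BIJ88Eq5612W6.gLoc ζ″ λ (G_k(□_α,u))_α` (= r18's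
`loc ζ″ (convexComb λ ·)` for real kernels, `gLoc_eq_loc_convexComb`), the cut-off `ζ″` as data (shape r18's `Zeta229`; constructed
profile p13's `BIJ88Cutoffs21.zeta229_cutoff`). [cite: BalabanImbrieJaffe1988, (2.28) p.263] -/
def gLocT (a c : ℝ) (U : GaugeField P j U1) (k : ℕ) (cube : ι → Finset (Balaban1983to89.Site P j))
    (lam : ι → Balaban1983to89.Site P j → Balaban1983to89.Site P j → ℝ) (ζ'' : Balaban1983to89.Site P j → Balaban1983to89.Site P j → ℝ) :
    Matrix (Balaban1983to89.Site P j) (Balaban1983to89.Site P j) ℂ :=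
  gLoc (fun x₁ x₂ => (ζ'' x₁ x₂ : ℂ)) (fun α x₁ x₂ => (lam α x₁ x₂ : ℂ)) fun α => gBox a c U k (cube α)

/-- kernel: the entries of (2.27). [cite: BalabanImbrieJaffe1988, (2.27) p.263] -/
theorem gTilde_apply (a c : ℝ) (U : GaugeField P j U1) (k : ℕ) (cube : ι → Finset (Balaban1983to89.Site P j))
    (lam : ι → Balaban1983to89.Site P j → Balaban1983to89.Site P j → ℝ) (x₁ x₂ : Balaban1983to89.Site P j) :
    gTilde a c U k cube lam x₁ x₂ = ∑ α, (lam α x₁ x₂ : ℂ) * gBox a c U k (cube α) x₁ x₂ := rfl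

/-- kernel: **(2.28) = `ζ″·`(2.27)** entrywise. [cite: BalabanImbrieJaffe1988, (2.28) p.263] -/
theorem gLocT_apply (a c : ℝ) (U : GaugeField P j U1) (k : ℕ) (cube : ι → Finset (Balaban1983to89.Site P j))
    (lam : ι → Balaban1983to89.Site P j → Balaban1983to89.Site P j → ℝ) (ζ'' : Balaban1983to89.Site P j → Balaban1983to89.Site P j → ℝ)
    (x₁ x₂ : Balaban1983to89.Site P j) :
    gLocT a c U k cube lam ζ'' x₁ x₂ = (ζ'' x₁ x₂ : ℂ) * gTilde a c U k cube lam x₁ x₂ := by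
  rw [gLocT, gLoc_apply, gTilde_apply]

/-- **`Q_k(u)`**, the full `k`-level covariant average of [I] (4.6.1) as a matrix (all blocks kept: `Q_k(u)|_T`). [cite: BalabanImbrieJaffe1985, (4.6.1) p.313] -/
def qMatT (U : GaugeField P j U1) (k : ℕ) : Matrix (Balaban1983to89.Site P (j+k)) (Balaban1983to89.Site P j) ℂ := qMatK U k univ

/-- kernel: `Q_k(u)` acts as p11's `qCovK U k`. [cite: BalabanImbrieJaffe1985, (4.6.1) p.313] -/
theorem qMatT_mulVec (U : GaugeField P j U1) (k : ℕ) (φ : Balaban1983to89.Site P j → ℂ) (y : Balaban1983to89.Site P (j+k)) :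
    (qMatT U k *ᵥ φ) y = qCovK U k φ y := by
  rw [qMatT, qMatK_mulVec, if_pos (subset_univ _)]

/-- kernel: the entries of `Q_k(u)`: `L^{−kd}u(Γ^{(k)}_{yx})` for `x ∈ B^k(y)`, else `0`. [cite: BalabanImbrieJaffe1985, (2.6) p.303] -/
theorem qMatT_apply (U : GaugeField P j U1) (k : ℕ) (y : Balaban1983to89.Site P (j+k)) (x : Balaban1983to89.Site P j) :
    qMatT U k y x = if x ∈ blockK k y then ((P.L : ℂ) ^ (k * P.d))⁻¹ * holCK U k x else 0 := by
  rw [qMatT, qMatK_apply]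
  simp only [subset_univ, true_and]

/-- **(2.34)** p. 263 [PDF 7], verbatim: *"We use G_{k,loc} to define a localized quadratic form for scalar fields, Δ_{k,loc}(u) = a_kI −
a_k²Q_k(u)G_{k,loc}(u)Q_k*(u). (2.34) Here we have simply replaced G_k(Ω,u) with G_{k,loc} in the definition of Δ_k(Ω,u); see (I.4.6.4)."*
— ON THE TORUS, with bodies: `a·1 − a²·Q_k(u)·G_{k,loc}(u)·Q_k(u)ᴴ` on `ℓ²(T^{(j+k)})` (the adjoint `Q_k^*` = conjugate transpose for the
uniform weights absorbed as in gen 10). [cite: BalabanImbrieJaffe1988, (2.34) p.263] -/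
def deltaLocT (a c : ℝ) (U : GaugeField P j U1) (k : ℕ) (cube : ι → Finset (Balaban1983to89.Site P j))
    (lam : ι → Balaban1983to89.Site P j → Balaban1983to89.Site P j → ℝ) (ζ'' : Balaban1983to89.Site P j → Balaban1983to89.Site P j → ℝ) :
    Matrix (Balaban1983to89.Site P (j+k)) (Balaban1983to89.Site P (j+k)) ℂ :=
  (a : ℂ) • (1 : Matrix _ _ ℂ) - ((a : ℂ) ^ 2) • (qMatT U k * gLocT a c U k cube lam ζ'' * (qMatT U k)ᴴ)

/-- **`Δ_k(Ω,u) = a_kI − a_k²Q_k(u)G_k(Ω,u)Q_k*(u)`** — [I] (4.6.4) with the REGION propagator `G_k(Ω,u)` (the comparison object of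
(2.31)/(2.35): *"replaced G_k(Ω,u) with G_{k,loc} in the definition of Δ_k(Ω,u)"*), with body on the torus. [cite: BalabanImbrieJaffe1988, (2.35) p.263] -/
def deltaRegion (a c : ℝ) (U : GaugeField P j U1) (k : ℕ) (Ω : Finset (Balaban1983to89.Site P j)) :
    Matrix (Balaban1983to89.Site P (j+k)) (Balaban1983to89.Site P (j+k)) ℂ :=
  (a : ℂ) • (1 : Matrix _ _ ℂ) - ((a : ℂ) ^ 2) • (qMatT U k * gBox a c U k Ω * (qMatT U k)ᴴ)

/-- **(4.12)** p. 275 [PDF 19], verbatim: *"φ_k = a_kG_{k,loc}(u_k)Q_k^*(u_k)φ, (4.12)"* — ON THE TORUS: the `η`-lattice minimizer of the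
unit-lattice field `φ` in the background `u`. [cite: BalabanImbrieJaffe1988, (4.12) p.275] -/
def phiKT (a c : ℝ) (U : GaugeField P j U1) (k : ℕ) (cube : ι → Finset (Balaban1983to89.Site P j))
    (lam : ι → Balaban1983to89.Site P j → Balaban1983to89.Site P j → ℝ) (ζ'' : Balaban1983to89.Site P j → Balaban1983to89.Site P j → ℝ)
    (φ : Balaban1983to89.Site P (j+k) → ℂ) : Balaban1983to89.Site P j → ℂ :=
  (a : ℂ) • (gLocT a c U k cube lam ζ'' * (qMatT U k)ᴴ) *ᵥ φ

/-- **(4.12) IS r18's `BIJ88Sect4Statements.phiK`** (the ring-free shape `a_k • G(Q^*φ)` over real-linear maps) instantiated with the torus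
objects `G = G_{k,loc}(u)`, `Q^* = Q_k(u)ᴴ` read as real-linear maps. [cite: BalabanImbrieJaffe1988, (4.12) p.275] -/
theorem phiKT_eq_phiK (a c : ℝ) (U : GaugeField P j U1) (k : ℕ) (cube : ι → Finset (Balaban1983to89.Site P j))
    (lam : ι → Balaban1983to89.Site P j → Balaban1983to89.Site P j → ℝ) (ζ'' : Balaban1983to89.Site P j → Balaban1983to89.Site P j → ℝ)
    (φ : Balaban1983to89.Site P (j+k) → ℂ) :
    phiKT a c U k cube lam ζ'' φ =
      BIJ88Sect4Statements.phiK a ((gLocT a c U k cube lam ζ'').mulVecLin.restrictScalars ℝ)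
        (((qMatT U k)ᴴ).mulVecLin.restrictScalars ℝ) φ := by
  rw [BIJ88Sect4Statements.phiK, phiKT, LinearMap.restrictScalars_apply, LinearMap.restrictScalars_apply, Matrix.mulVecLin_apply,
    Matrix.mulVecLin_apply, mulVec_mulVec]
  funext x
  simp only [Pi.smul_apply, smul_eq_mul, Complex.real_smul]

/-- **(2.34) IS r18's ring-level `BIJ88Sect2Statements.deltaLoc`** (= [I] (4.6.4) `BIJ85Sect4Statements.deltaScalar a_k Q G Q*`) in the
`ℝ`-algebra of complex matrices on `T^{(j+k)} ⊕ T^{(j)}`, with the rectangular `Q_k(u)`, `G_{k,loc}(u)`, `Q_k(u)ᴴ` embedded as blocks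
(p02's `deltaLoc_fromBlocks_toBlocks₁₁` is the real-kernel twin): its unit-lattice block is `Δ_{k,loc}(u)`. [cite: BalabanImbrieJaffe1988, (2.34) p.263] -/
theorem deltaLoc_blocks_eq_deltaLocT (a c : ℝ) (U : GaugeField P j U1) (k : ℕ) (cube : ι → Finset (Balaban1983to89.Site P j))
    (lam : ι → Balaban1983to89.Site P j → Balaban1983to89.Site P j → ℝ) (ζ'' : Balaban1983to89.Site P j → Balaban1983to89.Site P j → ℝ) :
    (BIJ88Sect2Statements.deltaLoc a
        (Matrix.fromBlocks 0 (qMatT U k) 0 (0 : Matrix (Balaban1983to89.Site P j) (Balaban1983to89.Site P j) ℂ))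
        (Matrix.fromBlocks (0 : Matrix (Balaban1983to89.Site P (j+k)) (Balaban1983to89.Site P (j+k)) ℂ) 0 0 (gLocT a c U k cube lam ζ''))
        (Matrix.fromBlocks 0 0 (qMatT U k)ᴴ (0 : Matrix (Balaban1983to89.Site P j) (Balaban1983to89.Site P j) ℂ))).toBlocks₁₁
      = deltaLocT a c U k cube lam ζ'' := by
  have hprod : Matrix.fromBlocks 0 (qMatT U k) 0 (0 : Matrix (Balaban1983to89.Site P j) (Balaban1983to89.Site P j) ℂ)
        * Matrix.fromBlocks (0 : Matrix (Balaban1983to89.Site P (j+k)) (Balaban1983to89.Site P (j+k)) ℂ) 0 0 (gLocT a c U k cube lam ζ'')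
        * Matrix.fromBlocks 0 0 (qMatT U k)ᴴ (0 : Matrix (Balaban1983to89.Site P j) (Balaban1983to89.Site P j) ℂ)
      = Matrix.fromBlocks (qMatT U k * gLocT a c U k cube lam ζ'' * (qMatT U k)ᴴ) 0 0
          (0 : Matrix (Balaban1983to89.Site P j) (Balaban1983to89.Site P j) ℂ) := by
    simp [Matrix.fromBlocks_multiply]
  unfold BIJ88Sect2Statements.deltaLoc BIJ85Sect4Statements.deltaScalar
  rw [hprod, deltaLocT]
  ext y₁ y₂
  simp [Matrix.toBlocks₁₁, Matrix.one_apply, Matrix.smul_apply, Matrix.sub_apply, Algebra.algebraMap_eq_smul_one]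

end Objects

/-! ## §3 Gauge covariance of `G̃_k`, `G_{k,loc}`, `Q_k`, `Δ_{k,loc}(u)`, `Δ_k(Ω,u)`; invariance of the scalar quadratic form -/

section Covariance

variable {ι : Type*} [Fintype ι] {k : ℕ} {a c : ℝ}

/-- **`G̃_k(u^h) = M_hG̃_k(u)M_hᴴ`** (every cube a union of `k`-blocks; real weights commute with the phases). [cite: BalabanImbrieJaffe1988, (2.27) p.263] -/
theorem gTilde_gaugeAct (hk : j + k ≤ P.m + P.K) (hc : c ≠ 0) (ha : 0 < a) (h : GaugeTransf P j U1) (U : GaugeField P j U1)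
    {cube : ι → Finset (Balaban1983to89.Site P j)} (hcube : ∀ α, IsBlockUnion k (cube α))
    (lam : ι → Balaban1983to89.Site P j → Balaban1983to89.Site P j → ℝ) :
    gTilde a c (gaugeAct h U) k cube lam = mulOp h * gTilde a c U k cube lam * (mulOp h)ᴴ := by
  ext x₁ x₂
  rw [mulOp_sandwich_apply, gTilde_apply, gTilde_apply, Finset.mul_sum, Finset.sum_mul]
  refine Finset.sum_congr rfl fun α _ => ?_
  rw [gBox_gaugeAct_apply hk hc ha h U (hcube α)]
  ring

/-- **`G_{k,loc}(u^h) = M_hG_{k,loc}(u)M_hᴴ`**. [cite: BalabanImbrieJaffe1988, (2.28) p.263] -/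
theorem gLocT_gaugeAct (hk : j + k ≤ P.m + P.K) (hc : c ≠ 0) (ha : 0 < a) (h : GaugeTransf P j U1) (U : GaugeField P j U1)
    {cube : ι → Finset (Balaban1983to89.Site P j)} (hcube : ∀ α, IsBlockUnion k (cube α))
    (lam : ι → Balaban1983to89.Site P j → Balaban1983to89.Site P j → ℝ) (ζ'' : Balaban1983to89.Site P j → Balaban1983to89.Site P j → ℝ) :
    gLocT a c (gaugeAct h U) k cube lam ζ'' = mulOp h * gLocT a c U k cube lam ζ'' * (mulOp h)ᴴ := by
  ext x₁ x₂
  rw [mulOp_sandwich_apply, gLocT_apply, gLocT_apply, gTilde_gaugeAct hk hc ha h U hcube lam, mulOp_sandwich_apply]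
  ring

/-- **(2.8)_k as a matrix identity: `Q_k(u^h) = M^{(k)}_hQ_k(u)M_hᴴ`** (standing range). [cite: BalabanImbrieJaffe1985, (2.8) p.303] -/
theorem qMatT_gaugeAct (hk : j + k ≤ P.m + P.K) (h : GaugeTransf P j U1) (U : GaugeField P j U1) :
    qMatT (gaugeAct h U) k = mulOpK h k * qMatT U k * (mulOp h)ᴴ := by
  ext y x
  rw [mulOpK, mulOp, sandwich_apply, qMatT, qMatT, qMatK_gaugeAct_apply hk]

/-- kernel: the adjoint side, `Q_k(u^h)ᴴ = M_hQ_k(u)ᴴM^{(k)}_hᴴ`. [cite: BalabanImbrieJaffe1985, (2.8) p.303] -/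
theorem qMatT_conjTranspose_gaugeAct (hk : j + k ≤ P.m + P.K) (h : GaugeTransf P j U1) (U : GaugeField P j U1) :
    (qMatT (gaugeAct h U) k)ᴴ = mulOp h * (qMatT U k)ᴴ * (mulOpK h k)ᴴ := by
  rw [qMatT_gaugeAct hk, conjTranspose_mul, conjTranspose_mul, conjTranspose_conjTranspose, Matrix.mul_assoc]

/-- kernel: the sandwich algebra `(M_cQM_fᴴ)(M_fGM_fᴴ)(M_fQᴴM_cᴴ) = M_c(QGQᴴ)M_cᴴ` for `M_fᴴM_f = 1`. [cite: BalabanImbrieJaffe1985, (6.3.2) p.320] -/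
private theorem sandwich_QGQ {m n : Type*} [Fintype m] [Fintype n] [DecidableEq n] (Mc : Matrix m m ℂ) (Mf : Matrix n n ℂ)
    (hf : Mfᴴ * Mf = 1) (Q : Matrix m n ℂ) (G : Matrix n n ℂ) :
    Mc * Q * Mfᴴ * (Mf * G * Mfᴴ) * (Mc * Q * Mfᴴ)ᴴ = Mc * (Q * G * Qᴴ) * Mcᴴ := by
  rw [conjTranspose_mul, conjTranspose_mul, conjTranspose_conjTranspose]
  calc Mc * Q * Mfᴴ * (Mf * G * Mfᴴ) * (Mf * (Qᴴ * Mcᴴ))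
      = Mc * Q * (Mfᴴ * Mf) * G * (Mfᴴ * Mf) * Qᴴ * Mcᴴ := by simp only [Matrix.mul_assoc]
    _ = Mc * (Q * G * Qᴴ) * Mcᴴ := by rw [hf, Matrix.mul_one, Matrix.mul_one]; simp only [Matrix.mul_assoc]

/-- **`Δ_{k,loc}(u^h) = M^{(k)}_hΔ_{k,loc}(u)M^{(k)}_hᴴ` — THE LOCALIZED SCALAR FORM IS GAUGE COVARIANT** (every `U(1)` field `u`, every
gauge transformation `h` of `T^{(j)}` read at the corner points on `T^{(j+k)}`, every cube family of `k`-block unions, every real weight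
and cut-off data, `a_k > 0`, `c ≠ 0`, standing range).  This is (6.3.2)/*"it is clear in the case of the quadratic forms for which we
write explicit formulas"* ([I] p. 320) for the CONCRETE `Δ_{k,loc}` of (2.34), and the mechanism of the scalar rotation `φ → e^{−ie_kηλ}φ`
in (5.4.5) p. 282. [cite: BalabanImbrieJaffe1985, (6.3.2) p.320] -/
theorem deltaLocT_gaugeAct (hk : j + k ≤ P.m + P.K) (hc : c ≠ 0) (ha : 0 < a) (h : GaugeTransf P j U1) (U : GaugeField P j U1)
    {cube : ι → Finset (Balaban1983to89.Site P j)} (hcube : ∀ α, IsBlockUnion k (cube α))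
    (lam : ι → Balaban1983to89.Site P j → Balaban1983to89.Site P j → ℝ) (ζ'' : Balaban1983to89.Site P j → Balaban1983to89.Site P j → ℝ) :
    deltaLocT a c (gaugeAct h U) k cube lam ζ'' = mulOpK h k * deltaLocT a c U k cube lam ζ'' * (mulOpK h k)ᴴ := by
  rw [deltaLocT, deltaLocT, qMatT_gaugeAct hk, gLocT_gaugeAct hk hc ha h U hcube, sandwich_QGQ _ _ (conjTranspose_mul_mulOp h)]
  simp only [Matrix.mul_sub, Matrix.sub_mul, Matrix.mul_smul, Matrix.smul_mul, Matrix.mul_one, mulOpK_mul_conjTranspose,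
    Matrix.mul_assoc]

/-- **`Δ_k(Ω,u^h) = M^{(k)}_hΔ_k(Ω,u)M^{(k)}_hᴴ`** for the region form (`Ω` a union of `k`-blocks). [cite: BalabanImbrieJaffe1985, (6.3.2) p.320] -/
theorem deltaRegion_gaugeAct (hk : j + k ≤ P.m + P.K) (hc : c ≠ 0) (ha : 0 < a) (h : GaugeTransf P j U1) (U : GaugeField P j U1)
    {Ω : Finset (Balaban1983to89.Site P j)} (hΩ : IsBlockUnion k Ω) :
    deltaRegion a c (gaugeAct h U) k Ω = mulOpK h k * deltaRegion a c U k Ω * (mulOpK h k)ᴴ := by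
  rw [deltaRegion, deltaRegion, qMatT_gaugeAct hk, gBox_gaugeAct hk hc ha h U hΩ, sandwich_QGQ _ _ (conjTranspose_mul_mulOp h)]
  simp only [Matrix.mul_sub, Matrix.sub_mul, Matrix.mul_smul, Matrix.smul_mul, Matrix.mul_one, mulOpK_mul_conjTranspose,
    Matrix.mul_assoc]

/-- kernel: a quadratic form is invariant under a unitary conjugation paired with the same rotation of the field:
`(Mψ)ᴴ(MΔMᴴ)(Mψ) = ψᴴΔψ` for `MᴴM = 1`. [cite: BalabanImbrieJaffe1985, (6.3.2) p.320] -/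
private theorem form_conj_invariant {m : Type*} [Fintype m] [DecidableEq m] {M : Matrix m m ℂ} (hM : Mᴴ * M = 1) (Δ : Matrix m m ℂ) (ψ : m → ℂ) :
    star (M *ᵥ ψ) ⬝ᵥ ((M * Δ * Mᴴ) *ᵥ (M *ᵥ ψ)) = star ψ ⬝ᵥ (Δ *ᵥ ψ) := by
  rw [star_mulVec, ← dotProduct_mulVec, mulVec_mulVec, mulVec_mulVec, Matrix.mul_assoc, Matrix.mul_assoc, hM, Matrix.mul_one,
    ← Matrix.mul_assoc, hM, Matrix.one_mul]

/-- **`⟨hψ, Δ_{k,loc}(u^h) hψ⟩ = ⟨ψ, Δ_{k,loc}(u)ψ⟩`** — the scalar quadratic form of (4.1)/(5.9.6) is invariant under the simultaneous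
gauge transformation of background and field (`(hψ)(y) = h(y_corner)ψ(y)`), for the CONCRETE torus `Δ_{k,loc}`; the sesquilinear pairing is
`ψᴴΔψ` (its real part is r18's `Term41.scalarForm` reading). [cite: BalabanImbrieJaffe1985, (6.3.2) p.320] -/
theorem form_deltaLocT_gaugeAct (hk : j + k ≤ P.m + P.K) (hc : c ≠ 0) (ha : 0 < a) (h : GaugeTransf P j U1) (U : GaugeField P j U1)
    {cube : ι → Finset (Balaban1983to89.Site P j)} (hcube : ∀ α, IsBlockUnion k (cube α))
    (lam : ι → Balaban1983to89.Site P j → Balaban1983to89.Site P j → ℝ) (ζ'' : Balaban1983to89.Site P j → Balaban1983to89.Site P j → ℝ)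
    (ψ : Balaban1983to89.Site P (j+k) → ℂ) :
    star (mulOpK h k *ᵥ ψ) ⬝ᵥ (deltaLocT a c (gaugeAct h U) k cube lam ζ'' *ᵥ (mulOpK h k *ᵥ ψ))
      = star ψ ⬝ᵥ (deltaLocT a c U k cube lam ζ'' *ᵥ ψ) := by
  rw [deltaLocT_gaugeAct hk hc ha h U hcube]
  exact form_conj_invariant (conjTranspose_mul_mulOpK h k) _ ψ

/-- **`Δ_{k,loc}(u^h; y₁,y₂) = h(y₁,corner)·Δ_{k,loc}(u; y₁,y₂)·conj h(y₂,corner)`** — the kernel form of the covariance.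
[cite: BalabanImbrieJaffe1985, (6.3.2) p.320] -/
theorem deltaLocT_gaugeAct_apply (hk : j + k ≤ P.m + P.K) (hc : c ≠ 0) (ha : 0 < a) (h : GaugeTransf P j U1) (U : GaugeField P j U1)
    {cube : ι → Finset (Balaban1983to89.Site P j)} (hcube : ∀ α, IsBlockUnion k (cube α))
    (lam : ι → Balaban1983to89.Site P j → Balaban1983to89.Site P j → ℝ) (ζ'' : Balaban1983to89.Site P j → Balaban1983to89.Site P j → ℝ)
    (y₁ y₂ : Balaban1983to89.Site P (j+k)) :
    deltaLocT a c (gaugeAct h U) k cube lam ζ'' y₁ y₂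
      = toC (h (cornerIter k y₁)) * deltaLocT a c U k cube lam ζ'' y₁ y₂ * (starRingEnd ℂ) (toC (h (cornerIter k y₂))) := by
  rw [deltaLocT_gaugeAct hk hc ha h U hcube, mulOpK]
  exact sandwich_apply _ _ _ _ _

/-- **TERMWISE INVARIANCE of the scalar quadratic form of (4.1)**: `conj((hψ)(y₁))·Δ_{k,loc}(u^h;y₁,y₂)·(hψ)(y₂) = conj(ψ(y₁))·Δ_{k,loc}(u;y₁,y₂)·ψ(y₂)`
— so every restricted double sum `Σ_{y₁,y₂∈Λ₈}` (r18's `Term41.scalarForm` shape, any `Λ₈`) is invariant under the simultaneous gauge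
transformation of background and field: the scalar-rotation step of (5.4.5) p. 282 for the CONCRETE `Δ_{k,loc}`. [cite: BalabanImbrieJaffe1988, (5.4.5) p.282] -/
theorem scalarForm_term_gaugeAct (hk : j + k ≤ P.m + P.K) (hc : c ≠ 0) (ha : 0 < a) (h : GaugeTransf P j U1) (U : GaugeField P j U1)
    {cube : ι → Finset (Balaban1983to89.Site P j)} (hcube : ∀ α, IsBlockUnion k (cube α))
    (lam : ι → Balaban1983to89.Site P j → Balaban1983to89.Site P j → ℝ) (ζ'' : Balaban1983to89.Site P j → Balaban1983to89.Site P j → ℝ)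
    (ψ : Balaban1983to89.Site P (j+k) → ℂ) (y₁ y₂ : Balaban1983to89.Site P (j+k)) :
    (starRingEnd ℂ) (toC (h (cornerIter k y₁)) * ψ y₁) * deltaLocT a c (gaugeAct h U) k cube lam ζ'' y₁ y₂ * (toC (h (cornerIter k y₂)) * ψ y₂)
      = (starRingEnd ℂ) (ψ y₁) * deltaLocT a c U k cube lam ζ'' y₁ y₂ * ψ y₂ := by
  rw [deltaLocT_gaugeAct_apply hk hc ha h U hcube, map_mul]
  linear_combination ((starRingEnd ℂ) (ψ y₁) * deltaLocT a c U k cube lam ζ'' y₁ y₂ * ψ y₂ * (toC (h (cornerIter k y₂)) *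
      (starRingEnd ℂ) (toC (h (cornerIter k y₂))))) * conj_mul_toC (h (cornerIter k y₁))
    + ((starRingEnd ℂ) (ψ y₁) * deltaLocT a c U k cube lam ζ'' y₁ y₂ * ψ y₂) * toC_mul_conj (h (cornerIter k y₂))

/-- **`⟨Λ₈(hψ), Δ_{k,loc}(u^h)Λ₈(hψ)⟩ = ⟨Λ₈ψ, Δ_{k,loc}(u)Λ₈ψ⟩`** for EVERY site set `Λ₈` (the restricted form of (4.1), real part = r18's
`Term41.scalarForm` reading). [cite: BalabanImbrieJaffe1988, (4.1) p.273] -/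
theorem scalarForm_sum_gaugeAct (hk : j + k ≤ P.m + P.K) (hc : c ≠ 0) (ha : 0 < a) (h : GaugeTransf P j U1) (U : GaugeField P j U1)
    {cube : ι → Finset (Balaban1983to89.Site P j)} (hcube : ∀ α, IsBlockUnion k (cube α))
    (lam : ι → Balaban1983to89.Site P j → Balaban1983to89.Site P j → ℝ) (ζ'' : Balaban1983to89.Site P j → Balaban1983to89.Site P j → ℝ)
    (ψ : Balaban1983to89.Site P (j+k) → ℂ) (Λ₈ : Finset (Balaban1983to89.Site P (j+k))) :
    ∑ y₁ ∈ Λ₈, ∑ y₂ ∈ Λ₈, (starRingEnd ℂ) (toC (h (cornerIter k y₁)) * ψ y₁) * deltaLocT a c (gaugeAct h U) k cube lam ζ'' y₁ y₂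
        * (toC (h (cornerIter k y₂)) * ψ y₂)
      = ∑ y₁ ∈ Λ₈, ∑ y₂ ∈ Λ₈, (starRingEnd ℂ) (ψ y₁) * deltaLocT a c U k cube lam ζ'' y₁ y₂ * ψ y₂ :=
  Finset.sum_congr rfl fun y₁ _ => Finset.sum_congr rfl fun y₂ _ => scalarForm_term_gaugeAct hk hc ha h U hcube lam ζ'' ψ y₁ y₂

/-- kernel: the rotated field entrywise, `(M^{(k)}_hψ)(y) = h(y_corner)ψ(y)`. [cite: BalabanImbrieJaffe1985, (2.8) p.303] -/
theorem mulOpK_mulVec (h : GaugeTransf P j U1) (k : ℕ) (ψ : Balaban1983to89.Site P (j+k) → ℂ) (y : Balaban1983to89.Site P (j+k)) :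
    (mulOpK h k *ᵥ ψ) y = toC (h (cornerIter k y)) * ψ y := by
  rw [mulOpK, mulVec_diagonal]

/-- **The same for the region form `Δ_k(Ω,u)`**. [cite: BalabanImbrieJaffe1985, (6.3.2) p.320] -/
theorem form_deltaRegion_gaugeAct (hk : j + k ≤ P.m + P.K) (hc : c ≠ 0) (ha : 0 < a) (h : GaugeTransf P j U1) (U : GaugeField P j U1)
    {Ω : Finset (Balaban1983to89.Site P j)} (hΩ : IsBlockUnion k Ω) (ψ : Balaban1983to89.Site P (j+k) → ℂ) :
    star (mulOpK h k *ᵥ ψ) ⬝ᵥ (deltaRegion a c (gaugeAct h U) k Ω *ᵥ (mulOpK h k *ᵥ ψ)) = star ψ ⬝ᵥ (deltaRegion a c U k Ω *ᵥ ψ) := by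
  rw [deltaRegion_gaugeAct hk hc ha h U hΩ]
  exact form_conj_invariant (conjTranspose_mul_mulOpK h k) _ ψ

/-- **`φ_k` transforms covariantly**: `φ_k[u^h](M^{(k)}_hψ) = M_hφ_k[u](ψ)` ((4.16)/(5.4.5): the background gauge transformation acts on
the minimizer by the phase). [cite: BalabanImbrieJaffe1988, (4.16) p.276] -/
theorem phiKT_gaugeAct (hk : j + k ≤ P.m + P.K) (hc : c ≠ 0) (ha : 0 < a) (h : GaugeTransf P j U1) (U : GaugeField P j U1)
    {cube : ι → Finset (Balaban1983to89.Site P j)} (hcube : ∀ α, IsBlockUnion k (cube α))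
    (lam : ι → Balaban1983to89.Site P j → Balaban1983to89.Site P j → ℝ) (ζ'' : Balaban1983to89.Site P j → Balaban1983to89.Site P j → ℝ)
    (ψ : Balaban1983to89.Site P (j+k) → ℂ) :
    phiKT a c (gaugeAct h U) k cube lam ζ'' (mulOpK h k *ᵥ ψ) = mulOp h *ᵥ phiKT a c U k cube lam ζ'' ψ := by
  rw [phiKT, phiKT, gLocT_gaugeAct hk hc ha h U hcube, qMatT_conjTranspose_gaugeAct hk, mulVec_smul, mulVec_mulVec, mulVec_mulVec]
  congr 1
  congr 1
  simp only [Matrix.mul_assoc]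
  rw [← Matrix.mul_assoc ((mulOp h)ᴴ) (mulOp h), conjTranspose_mul_mulOp, Matrix.one_mul, conjTranspose_mul_mulOpK, Matrix.mul_one]

end Covariance

/-! ## §4 (2.37): the support of `Δ_{k,loc}(u)` — the combinatorial core -/

section Support

variable {ι : Type*} [Fintype ι]

/-- kernel: `(QGQᴴ)(y₁,y₂) = Σ_{x₁∈B^k(y₁)}Σ_{x₂∈B^k(y₂)} Q(y₁,x₁)G(x₁,x₂)conj Q(y₂,x₂)` vanishes as soon as `G` vanishes on
`B^k(y₁) × B^k(y₂)`. [cite: BalabanImbrieJaffe1988, (2.37) p.263] -/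
theorem qGq_apply_eq_zero (U : GaugeField P j U1) (k : ℕ) (G : Matrix (Balaban1983to89.Site P j) (Balaban1983to89.Site P j) ℂ)
    {y₁ y₂ : Balaban1983to89.Site P (j+k)} (hG : ∀ x₁ ∈ blockK k y₁, ∀ x₂ ∈ blockK k y₂, G x₁ x₂ = 0) :
    (qMatT U k * G * (qMatT U k)ᴴ) y₁ y₂ = 0 := by
  rw [Matrix.mul_apply]
  refine Finset.sum_eq_zero fun x₂ _ => ?_
  rw [Matrix.mul_apply, conjTranspose_apply, qMatT_apply]
  by_cases h2 : x₂ ∈ blockK k y₂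
  · rw [Finset.sum_mul]
    refine Finset.sum_eq_zero fun x₁ _ => ?_
    rw [qMatT_apply]
    by_cases h1 : x₁ ∈ blockK k y₁
    · rw [hG x₁ h1 x₂ h2, mul_zero, zero_mul]
    · rw [if_neg h1, zero_mul, zero_mul]
  · rw [if_neg h2, star_zero, mul_zero]

/-- **(2.37) p. 263, verbatim: *"Δ_{k,loc}(u; x₁,x₂) = 0 for |x₁ − x₂| ≧ (1/2L) r(e_{k−1}). (2.37)"* — THE MECHANISM on the torus objects:**
an off-diagonal entry `Δ_{k,loc}(u; y₁,y₂)`, `y₁ ≠ y₂`, vanishes as soon as the cut-off `ζ″` vanishes on `B^k(y₁) × B^k(y₂)` (which is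
(2.29)'s `ζ″ = 0 for |x₁ − x₂| ≧ (1/4L)r(e_{k−1})` once the two blocks are far; the metric bookkeeping `(1/4L)r + 2·diam B^k ≤ (1/2L)r` is
r18's `trunc_vanishes`/p02's `vanishes237_of_zeta229` currency and is not redone here). [cite: BalabanImbrieJaffe1988, (2.37) p.263] -/
theorem deltaLocT_apply_eq_zero (a c : ℝ) (U : GaugeField P j U1) (k : ℕ) (cube : ι → Finset (Balaban1983to89.Site P j))
    (lam : ι → Balaban1983to89.Site P j → Balaban1983to89.Site P j → ℝ) (ζ'' : Balaban1983to89.Site P j → Balaban1983to89.Site P j → ℝ)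
    {y₁ y₂ : Balaban1983to89.Site P (j+k)} (hy : y₁ ≠ y₂) (hζ : ∀ x₁ ∈ blockK k y₁, ∀ x₂ ∈ blockK k y₂, ζ'' x₁ x₂ = 0) :
    deltaLocT a c U k cube lam ζ'' y₁ y₂ = 0 := by
  rw [deltaLocT, Matrix.sub_apply, Matrix.smul_apply, Matrix.smul_apply, Matrix.one_apply_ne hy, smul_zero, zero_sub, neg_eq_zero,
    qGq_apply_eq_zero U k _ (fun x₁ h1 x₂ h2 => by rw [gLocT_apply, hζ x₁ h1 x₂ h2, Complex.ofReal_zero, zero_mul]), smul_zero]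

/-- **The kernel of `Δ_{k,loc}(u)` as a function of the background read in `ℂ`-valued bond variables on its support**: the entries are
Hermitian-symmetric, `Δ(y₂,y₁) = conj Δ(y₁,y₂)`, whenever every `G_k(□_α,u)` is (cubes unions of `k`-blocks) and the weight/cut-off data
are symmetric — the shape in which (4.1) pairs it with `φ̄(x)…φ(y)` (r18's `Term41.scalarForm`). [cite: BalabanImbrieJaffe1988, (2.34) p.263] -/
theorem deltaLocT_conjTranspose {k : ℕ} (hk : j + k ≤ P.m + P.K) {a c : ℝ} (hc : c ≠ 0) (ha : 0 < a) (U : GaugeField P j U1)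
    {cube : ι → Finset (Balaban1983to89.Site P j)} (hcube : ∀ α, IsBlockUnion k (cube α))
    {lam : ι → Balaban1983to89.Site P j → Balaban1983to89.Site P j → ℝ} (hlam : ∀ α x₁ x₂, lam α x₂ x₁ = lam α x₁ x₂)
    {ζ'' : Balaban1983to89.Site P j → Balaban1983to89.Site P j → ℝ} (hζ : ∀ x₁ x₂, ζ'' x₂ x₁ = ζ'' x₁ x₂) :
    (deltaLocT a c U k cube lam ζ'')ᴴ = deltaLocT a c U k cube lam ζ'' := by
  have hG : (gLocT a c U k cube lam ζ'')ᴴ = gLocT a c U k cube lam ζ'' := by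
    ext x₁ x₂
    rw [conjTranspose_apply, gLocT_apply, gLocT_apply, gTilde_apply, gTilde_apply, Complex.star_def, map_mul, Complex.conj_ofReal, hζ,
      map_sum]
    congr 1
    refine Finset.sum_congr rfl fun α _ => ?_
    rw [map_mul, Complex.conj_ofReal, hlam, ← Complex.star_def, ← conjTranspose_apply (gBox a c U k (cube α)) x₂ x₁,
      gBox_conjTranspose (isUnit_nPad hk hc ha U (hcube α))]
  rw [deltaLocT, conjTranspose_sub, conjTranspose_smul, conjTranspose_smul, conjTranspose_one, conjTranspose_mul, conjTranspose_mul,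
    conjTranspose_conjTranspose, hG, ← Matrix.mul_assoc]
  simp only [Complex.star_def, map_pow, Complex.conj_ofReal]

end Support

/-! ## §5 (5.6.12) with `w₆` for the TORUS `G_{k,loc}` — the per-cube (5.6.11) hypotheses of my gen-11 chain DISCHARGED -/

section Expansion

variable {ι : Type*} [Fintype ι] {k : ℕ} {a c : ℝ}

/-- **The two displays at the foot of p. 287 for the torus `G_{k,loc}`**, verbatim: *"We insert this into G_{j,loc}(ũ_{k+1}ũ) to obtain … We
obtain G_{j,loc}(ũ_{k+1}ũ) = G_{j,loc}(ũ_{k+1}) + G_{j,loc}(ũ_{k+1})V_jG_{j,loc}(ũ_{k+1}ũ) + w′₆."* — EXACT for the constructed objects of ANY two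
`U(1)` fields `u`, `u′` (cubes unions of `k`-blocks), with `w′₆` my gen-11 defect `w6prime` built from the per-cube `V_j(□_α) = H_{□_α}(u) −
H_{□_α}(u′)` and the (unpinned, as in print) middle operator `V_j`: the per-cube resolvent identities that gen 11's `oneStep_w6prime` took as
hypotheses are the companion's `eq5611_gBox`. [cite: BalabanImbrieJaffe1988, (5.6.12) p.287] -/
theorem oneStep_gLocT (hk : j + k ≤ P.m + P.K) (hc : c ≠ 0) (ha : 0 < a) {cube : ι → Finset (Balaban1983to89.Site P j)}
    (hcube : ∀ α, IsBlockUnion k (cube α)) (lam : ι → Balaban1983to89.Site P j → Balaban1983to89.Site P j → ℝ)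
    (ζ'' : Balaban1983to89.Site P j → Balaban1983to89.Site P j → ℝ) (U U' : GaugeField P j U1)
    (Vj : Matrix (Balaban1983to89.Site P j) (Balaban1983to89.Site P j) ℂ) :
    gLocT a c U' k cube lam ζ'' = gLocT a c U k cube lam ζ'' + gLocT a c U k cube lam ζ'' * Vj * gLocT a c U' k cube lam ζ''
      + w6prime (fun x₁ x₂ => (ζ'' x₁ x₂ : ℂ)) (fun α x₁ x₂ => (lam α x₁ x₂ : ℂ)) (fun α => gBox a c U k (cube α))
          (fun α => nOp a c U k (cube α) - nOp a c U' k (cube α)) (fun α => gBox a c U' k (cube α)) Vj :=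
  oneStep_w6prime _ _ (fun α => eq5611_gBox hk hc ha (hcube α) U U') Vj

/-- **(5.6.12) p. 288 WITH ITS KERNEL `w₆`, FOR THE TORUS `G_{k,loc}` — verbatim: *"This is now iterated to yield G_{j,loc}(ũ_{k+1}ũ) =
Σ_{n=0}^{n̄} G_{j,loc}(ũ_{k+1})[V_jG_{j,loc}(ũ_{k+1})]ⁿ + G_{j,loc}(ũ_{k+1})[V_jG_{j,loc}(ũ_{k+1})]^{n̄}V_jG_{j,loc}(ũ_{k+1}ũ) + w₆, (5.6.12) with another
small kernel w₆."*** — EXACT, every `n̄`, with `w₆ = Σ_{n≤n̄}(G_{k,loc}V_j)ⁿw′₆` (gen 11's `w6`), for the constructed torus objects of any two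
`U(1)` fields; my gen-11 `eq5612_gLoc`/`eq5612_neumann` carried the per-cube whole-lattice invertibilities `G_α·H_α = 1` as hypotheses
(satisfiable only for `□_α = T`) — here there is no hypothesis beyond the data (the SIZE of `w′₆`, `w₆` stays print's claim, gen 11's
`norm_w6_le` gives `w₆ = O(w′₆)`). [cite: BalabanImbrieJaffe1988, (5.6.12) p.288] -/
theorem eq5612_gLocT (hk : j + k ≤ P.m + P.K) (hc : c ≠ 0) (ha : 0 < a) {cube : ι → Finset (Balaban1983to89.Site P j)}
    (hcube : ∀ α, IsBlockUnion k (cube α)) (lam : ι → Balaban1983to89.Site P j → Balaban1983to89.Site P j → ℝ)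
    (ζ'' : Balaban1983to89.Site P j → Balaban1983to89.Site P j → ℝ) (U U' : GaugeField P j U1)
    (Vj : Matrix (Balaban1983to89.Site P j) (Balaban1983to89.Site P j) ℂ) (N : ℕ) :
    gLocT a c U' k cube lam ζ''
      = (∑ n ∈ Finset.range (N + 1), gLocT a c U k cube lam ζ'' * (Vj * gLocT a c U k cube lam ζ'') ^ n)
        + gLocT a c U k cube lam ζ'' * (Vj * gLocT a c U k cube lam ζ'') ^ N * Vj * gLocT a c U' k cube lam ζ''
        + w6 (gLocT a c U k cube lam ζ'') Vj
            (w6prime (fun x₁ x₂ => (ζ'' x₁ x₂ : ℂ)) (fun α x₁ x₂ => (lam α x₁ x₂ : ℂ)) (fun α => gBox a c U k (cube α))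
              (fun α => nOp a c U k (cube α) - nOp a c U' k (cube α)) (fun α => gBox a c U' k (cube α)) Vj) N :=
  eq5612_gLoc _ _ (fun α => eq5611_gBox hk hc ha (hcube α) U U') Vj N

end Expansion

end

end Literature.MathematicalPhysics.QuantumFieldTheory.BalabanImbrieJaffe1984to88.BIJ88DeltaLoc234Torus
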